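import Literature.MathematicalPhysics.QuantumFieldTheory.Balaban1983to89.B8Thm2TorusAt
import Literature.MathematicalPhysics.QuantumFieldTheory.Balaban1983to89.B8Eq155JBound
import Literature.MathematicalPhysics.QuantumFieldTheory.Balaban1983to89.B8Prop5Reality

/-!
# `Balaban1983to89.B8Carve02GaugeFixingHyp` — T. Bałaban, *Spaces of regular gauge field configurations on a lattice and gauge
# fixing conditions*, Commun. Math. Phys. **99** (1985) 75–102 [Balaban1985RegularSpaces] ("B8"), **pp. 83–88 [PDF 9–14]: Theorem 2,
# Proposition 3, Theorem 4 and the displays (1.40)–(1.73)** — P6 CARVING FAN block 02 (`pub/lit-balaban/carve/BLOCKS-01-10.md` row 02):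
# the section's printed statements GATHERED BY NAME into one hypothesis-form bundle `Hyp` keyed to the consumer of record
# (stmt-QuantumFields-19200, which reads Theorem 2 through `B8Thm2TorusAt.Thm2TorusAt`), plus the residual printed sentences of
# pp. 83–88 that had no declaration

statement-level skeleton of published theorems with citation tags; proofs where landed; nothing here is a claim about the
Yang–Mills mass gap

PDF held: `paper:balaban1985-cmp99-regular-spaces-gauge-fixing` (journal page = PDF page + 74); pp. 83, 85, 86, 87, 88 [PDF 9, 11, 12, 13, 14]
READ AS IMAGES by this seat (renders `run/shared/lean/pub/pub-balaban/b2b-balaban-ref1/pages/1985-cmp99-regular-spaces-gauge-fixing/…-p009/p011/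
p012/p013/p014-x2.png`, 2026-08-28), pp. 82–89 also on the `lit read` text layer; the [B8] reader's transcript
`pub/lit-balaban/lit-balaban-r05/ROWS-B8.md` §Sect. C consulted for the row ↦ decl map.

CITATION HEADER (lean-in-tree rule).  Cell `lit-balaban` (mega-formalisation of Bałaban CMP 1983–89), unit `lit-balaban-carve-02` (D-0154 (3b),
carver seat of block 02; HOME `run/shared/lean/pub/lit-balaban/carve/`).  WHAT IS REPRODUCED = SKELETON v3.365 rows B8.Thm2, B8.Prop3, B8.Thm4,
B8.Eq1.40, B8.Eq1.43, B8.Eq1.49, B8.Eq1.54, B8.Eq1.55, B8.Def§C, B8.Eq1.56, B8.Eq1.58, B8.Eq1.59, B8.Eq1.62, B8.Eq1.64, B8.Eq1.65, B8.Eq1.69,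
B8.Eq1.72 — ALL SEVENTEEN ARE IN THE TREE and are CITED BY NAME here, never restated (rule «in tree = cite»):

| row ∕ printed item (page) | in tree (cite; `Literature.MathematicalPhysics.QuantumFieldTheory.Balaban1983to89.` omitted) |
|---|---|
| Theorem 2 (p. 83) | `B8.Thm2Printed` (abstract carrier `B8.GFData`); torus geometry `Ω_j = T_η`: `B8Thm2TorusAt.Thm2TorusAt`, `.Thm2TorusUniform` (print's quantifier order «There exist constants B₁, B₂(β₀), c₁ …»), `.Concl2T` ∕ `.C136T` ∕ `.C137T` ∕ `.C139T` ((1.36)–(1.39) for `Ω_j = T_η`); Setup-torus objects: `B8Thm2SetupTorus.Thm2SetupAt`; general `{Ω_j}` on `ℤᵈ`: `B8LeafModelZd3.zdGF3` members; at explicit constants: `B8Thm2AtConstants.thm2ExistsAt_of_bodies` ∕ `thm2UniqueAt_of_bodies` |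
| (1.40)–(1.42) (p. 83), Proposition 3 (p. 87), (1.61) (p. 86) | `B8.Prop3Body` ∕ `B8.Prop3Printed` (abstract, `B8.GFData2`), `B8.Prop3Constants`, `B8.B9Inputs` («B₀, B₀(β₀) … norms of the operators G(U₀), H(U₀)»); `ℤᵈ` family: `B8LeafModelZd3.prop3Printed_zd3` (PROVED modulo the socket `SockB9P3` = [4] Thm 3.3), `B8Prop3KLevel`, `B8Prop3Concrete` |
| (1.43)–(1.45), the p. 84 sentences «bounded by 4α₂α₀(Lʲη)⁻³η³», «8dα₂α₀(Lʲη)⁻³η²», the unnumbered display «\|D^{η*}_{U₁U₀}∂U₀ − D^{η*}_{U₀}∂U₀\| < 2dα₀α₂(Lʲη)⁻³η²» and (1.44) with `O₁(10dα₀α₂…)` | PROVED: `B8Eq143PlaqExpansion.eq143`, `.rem43`, `.norm_rem43_le_printed`, `.norm_pdiv_rem43_le_printed`, `.norm_pdiv_plaqF_sub_covDiv_le_printed`, `.eq144_printed`, `.eq145_covPlaq` |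
| (1.46)–(1.49) (pp. 84–85) incl. the `O₁(3\|ηA\|²)`, `O₁(2α₂…)`, `O₁(8α₂²…)`, `28d`, `1∕3!`, `(4³∕3)d` sentences | PROVED ∕ DEF: `B8Eq146AExpansion.eq146_printed`, `.eq147_printed`, `.eq148_printed`, `.V2` ((1.49) first member verbatim), `.V2_eq_sq_add_commutators` ((1.49) second member; ring identity `B8.v2_identity`), `.expansion_R_printed`, `.first_order_R_printed`, `.eq147_ord1_printed` |
| (1.50)–(1.54) (p. 85) incl. the transport identity «(D*_μA)(x) = −R(U₀(x − ηe_μ, x))(D_μA)(x − ηe_μ)» | PROVED: `B8Eq151V2Divergence.eq150` (ring identity `B8.commutators_150`), `.eq151_printed`, `.eq152`, `.covDeriv_eq_neg_conjR_covDerivFwd`, `.eq153_printed`, `.eq154_printed`; `.brk` = the bracket `{…}` of (1.49) |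
| (1.55) and the p. 86 sentence «From (1.40) the term on the left-hand side and the first term … estimated by α₀(Lʲη)⁻³η²» | PROVED: `B8Eq155JBound.eq155_printed`, `.eq155_norm`, `.eq155_hermitian` (`.Jcur` = `J = D^{η*}_{U₀}D^η_{U₀}A`; hypotheses `h40₀`∕`h40₁`) |
| Def §C «\|A\|_(α) = sup_j sup_{Ω_j}(Lʲη)^{−α}\|A\|» (p. 86) | DEF: one level `B8Eq155JBound.wsup` (`jNorm3`, `gradNorm2`); multi-level `B8ScaledSupNorm.msup` ∕ `bondNorm` ∕ `covGradNorm` (its `msup_mono_mem` is the p. 88 mechanism «they hold for k − 1, if they hold for k») |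
| (1.56) «Proposition 4 from [3] implies …, \|B₁\| < 2dLα₁ + C₂α₂²» (p. 86) | PROVED on the `ℤᵈ` carriers from [3] Prop. 4: `B8Eq156Prop4.eq156`, `.eq156_of_141`, `.norm_B1_lt`, `.apriori_160_of_156` |
| (1.57)–(1.58), the translation `A = A₁ + H(U₀)B₁`, the recalled definition of `G(U₀)` (p. 86) | PROVED: `B8FromB9.b8_158_identity` (second line of (1.58), `H(U₀)` cancels), `B8Eq157Translation` ((1.57), both lines of (1.58), `G8 = G(U₀)`, `H(U₀)` = [4] (3.109)–(3.111) by name `B9Eq3112.hOp`) |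
| (1.59) «Theorem 3.3 of [4] implies the bounds … ≦ B₀(\|J\|₍₋₃₎ + \|B₁\|)» (p. 86) | `B8FromB9.b8_159_transfer` ∕ `.b8_159_repaired` (PROVED modulo the B9 leaf `B9.Thm33Printed`); torus socket of record `B8Thm2TorusSupplier.Sock159` ∕ `.Lines159` (desk row G-B8-T2S, cited only); cube member at `U₀ = 1`: `B8Ineq159FlatCubeMemberPrinted.Ineq159FlatCubeMemberPrinted` (named fact) |
| (1.60) with «let us assume that B₀36dα₂ ≦ 1∕2», (1.61), (1.62) (pp. 86–87) | PROVED (real arithmetic): `B8.apriori_160` (unprinted harmless side condition `50dα₂ ≤ 1`, census C-B8-8), `B8.apriori_162`, `B8Eq155JBound.apriori_160_of_155` |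
| (1.63)–(1.64) (p. 87) | the ∃-schedule form `B8.thm2_schedule_exists`, at explicit thresholds `B8Thm2AtConstants.thm2_schedule_of_le`; THE LITERAL DISPLAYS had no declaration — typed AND proved below (`Ineq163Printed`, `Restriction164Printed`, `ineq163_of_164`, `restriction161_of_164`) |
| (1.65)–(1.66) (pp. 87–88) incl. «By Proposition 2 of [3] … < 2α₀L^{2j}η²» and the Lemma-1 iteration | PROVED: `B8.ineq165` (`8d²∕(1 − L⁻²) ≤ 32d²∕3 < 11d²`), `B8Ineq165AllLevels.norm_avg_sub_le_allLevels_of135` ((1.65) at every level from the genuine (1.35)), `B8Eq166ConstraintPair.ineq166_pair` (the descent at a pair), `B8LeafModelZd3Ineq165`; (1.66): `B8.GFData.avgClose166` (abstract), `B8Prop6OfThm4.Cond166` (cubes), `B8Thm4TorusAt.Cond166T` (torus) |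
| Theorem 4 (p. 88), «Of course this theorem implies Theorem 2. Proposition 3 implies that it is enough to prove (1.37), (1.38) and (1.67)» | `B8.Thm4Printed` ∕ `B8.Thm4Body` ∕ `thm4Printed_iff` (abstract; (1.62) read as its \|A\|-member (1.67) with constant `B′₁`, print slip G-B8-02 `B′₁ = 5dLC′₁B₀`), `B8.thm2_of_thm4_prop3` (the p. 88 reduction, kernel-checked over the carrier), `B8.Thm4SkeletonR` (the induction pp. 88–95); cubes: `B8Eq119TwistedAxial.Thm4At`; torus: `B8Thm4TorusAt.Thm4TorusAt` (`Reg`∕`Restr`∕`Concl` abstract); torus Theorem 2 from sockets (desk row G-B8-T2S, cited only): `B8Thm2TorusSupplier.thm2_torus_pair`, `B8Thm2TorusAtOfLetters` |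
| p. 88 «they imply the same conditions for k − 1 (we do not consider the set Ω_k)» | PROVED: `B8Thm4TruncationLocal.inAk_truncate`, `.inAx_truncate`, `.restr129_truncate_iff_cond168` |
| (1.68)–(1.69) (p. 88) | `B8Eq178Averages.Cond168` ((1.68) concrete, print's `k ↦ k + 1`), `.restr129_of_cond168`; (1.69): `B8Eq178Averages.Cond169` (concrete, levels `j < k`), `B8.Thm4Skeleton` leaf `Ind`, `B8.LandauData.Hyp169` |
| (1.70)–(1.73) (p. 88) «From (64)–(87) of [3] it follows that u₁ is determined uniquely in terms of U₁ and is given by (106)» | PROVED over the [3] averaging data: `B8Ineq170.u106`, `B8Ineq170` §(1.70)–(1.74); the constant `8d∕(1 − L⁻¹) ≤ 16d` of (1.72): `B8.ineq172` |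

WHAT THIS FILE ADDS (kernel-checked, 0 sorry, std axioms; no `instance`, no `notation`; every `def` is a hypothesis SHAPE with a body or a
printed display, asserted for nothing):
* §1 p. 85, the sentence after (1.49) «This equality holds for arbitrary A in the complexified Lie algebra, but if A is Hermitian, then the first
  expression above is a real part of V₂, and the second is an imaginary part of V₂, multiplied by i.» — listed as NOT typed in
  `B8Eq151V2Divergence` (HONEST SCOPE (vi)): `V2HermitianSplitPrinted` (the first member `(Σᵢxᵢ)² = η²((D^η_{U₀}A)(p))²` of the second line of
  (1.49) is self-adjoint, the bracket `{…}` is skew-adjoint) and its PROOF `v2HermitianSplit_of_selfAdjoint` for bondwise Hermitian `A` over a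
  unitary-valued background (so `V₂⋆ = (Σᵢxᵢ)² − {…}`, `star_V2_of_selfAdjoint`; `V₂ + V₂⋆ = 2(Σᵢxᵢ)²`, `V₂ − V₂⋆ = 2{…}`).
* §2 p. 87, the LITERAL displays (1.63)–(1.64) (the restriction on `α₀ + α₁` that makes (1.61) hold at `α₂ = B′₁(α₀ + α₁) = C′₁B₁(α₀ + α₁)`),
  read on the page render p013-x2 (p. 87): `Ineq163Printed` (first relation STRICT as printed), `Restriction164Printed` (print's form
  `(20dB₁C′₁ + 2(1 + C₂)B₁²C′₁²)(α₀ + α₁) ≦ 1`; `coeff164_eq` identifies its coefficient with that of (1.63)), and the two printed implications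
  PROVED: `ineq163_of_164` («The restriction follows from the bounds (1.63), hence from (1.64)») and `restriction161_of_164` ((1.64) ⇒ (1.61) in
  the `h61`-shape of `B8.Prop3Body`).
* §3 the torus letters (`Ω_j = T_η`, `j ≤ k`, p. 77 admitted case; the consumer's geometry): `C167T` — (1.41) ∕ (1.62)₁ ∕ (1.67) «\|A\| < b·s·(Lʲη)⁻¹
  on Ω_j» (the torus reading of the carrier field `B8.GFData.C162`, the member `B8Thm2TorusAt.Thm2TorusAt.exists_sup` spells inline);
  `Concl4T` — Theorem 4's printed conclusion list «(1.37), (1.38), (1.62)» for `U₁ = U′^{u⁻¹}` in the tree's reading of record of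
  `B8.Thm4Printed` ((1.62) ↦ its \|A\|-member (1.67) with constant `B′₁`), token-parallel to `B8Thm2TorusAt.Concl2T`; `concl4T_of_concl2T` (the
  torus instance of the carrier law `h136_162`∕`hmono162` of `B8.thm2_of_thm4_prop3`: (1.36)–(1.39) at `B₁ ≤ B′₁` give (1.37), (1.38), (1.67));
  `Thm4TorusReadAt` := `B8Thm4TorusAt.Thm4TorusAt` with `Restr := Restr129 L k (torusLam k)` and `Concl := Concl4T … B′₁` (BY NAME); `Thm4TorusFullAt`
  := the same with `Concl := B8Thm2TorusAt.Concl2T … (5dLB₀) (5dLB₀(β₀))` — Theorem 4 with (1.62) read IN FULL (all four members at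
  Proposition 3's constants, which is why «Of course this theorem implies Theorem 2»); `Prop3TorusBody` ∕ `Prop3TorusAt` — Proposition 3 with
  (1.40)–(1.42) and (1.61) for `Ω_j = T_η`, token-parallel to `B8.Prop3Body` ∕ `B8.Prop3Printed`, members BY NAME (`InAk`, `C167T … 1 α₂`,
  `IsLandau138`, `C137T`; conclusion `C136T`∕`C139T` at `5dLB₀`, `5dLB₀(β₀)`).
* §4 THE BUNDLE `Hyp L k P η β₀ B₀ B₀β C₂ B₁ B₂ c₂ B₁' c₄ len G Reg` := `Thm2TorusAt … ∧ Prop3TorusAt … ∧ Thm4TorusReadAt … ∧ Thm4TorusFullAt …`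
  (Theorem 2 ∧ Proposition 3 ∧ Theorem 4 in both readings, for `Ω_j = T_η`), with the projections `Hyp.thm2` … `Hyp.thm4Full`, so that a node
  prover can take `(h : B8Carve02GaugeFixingHyp.Hyp …)`; filed `--supports stmt-QuantumFields-19200 --as helper`.

* §5 (v1.1) PRINT'S QUANTIFIER ORDER, displayed: «α₀, α₁, α₂ bounded by a constant depending on d and L only» (Prop. 3), «There exists a constant
  c₁ …» (Thm 4), «with an absolute constant C′₁, i.e. a constant depending on d and L only» ((1.67)) — ONE threshold ∕ constant, given `d`, `L`, the
  gauge group and the [3]∕[4] letters, serves EVERY member `k ≥ 1`, `P`, `η > 0` (the clause «(3.35) of [4]» may depend on the member):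
  `Prop3TorusUniform`, `Thm4TorusReadUniform`, `Thm4TorusFullUniform`, token-parallel to `B8Thm2TorusAt.Thm2TorusUniform`; the block in that order
  `HypUniform := Thm2TorusUniform ∧ Prop3TorusUniform ∧ Thm4TorusReadUniform ∧ Thm4TorusFullUniform`; the member instances follow
  (`prop3TorusAt_of_uniform`, `thm4TorusAt_anti` — the interface is antitone in its threshold —, `hyp_of_uniform`).

REVISION v1.1 (same seat, 2026-08-28) — APPEND-ONLY (§5) + DOCSTRING-ONLY additions to the table above ((1.59): `B8Ineq159FlatCubeMemberPrinted`;
(1.65): `B8Ineq165AllLevels`; (1.69): `B8Eq178Averages.Cond169`); no v1 declaration line changed.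

HONEST SCOPE ∕ DECLARED READINGS.  (i) Nothing of the paper is proved here beyond §1–§2 (finite algebra ∕ real arithmetic) and the
bookkeeping law `concl4T_of_concl2T`; Theorem 2, Proposition 3, Theorem 4 are HYPOTHESIS SHAPES (the tree proves the p. 88 reduction over
the abstract carrier, `B8.thm2_of_thm4_prop3`, and Theorem 2 on the torus from sockets, `B8Thm2TorusSupplier.thm2_torus_pair` — desk row
G-B8-T2S, not re-derived here).  (ii) «(3.35) of [4]» stays the abstract `Reg` exactly as in `Thm2TorusAt` ∕ `Thm4TorusAt` (concrete instance of
record `B8Eq133Hypotheses.Reg335Zd`; print drops it via Prop. 6, p. 82).  (iii) `T_η` is read as `P`-periodic data on `ℤᵈ` (the lineage's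
reading, `B12Ineq417Flat.shiftCfg`); `U₁ = e^{iηA}` is `B8Eq184Proof.cfgExp η A` with `A` bondwise self-adjoint (print: Hermitian, gauge group
`U(N)`), and `G`-valuedness of `e^{iηA}` is an explicit hypothesis of `Prop3TorusBody` (for `G = SU(N)` it carries the trace condition).  (iv) Strict
`<` as printed in the hypothesis shapes.  (v) The two readings of Theorem 4's «(1.62)» are both displayed (`Thm4TorusReadAt` = the tree's F6 reading
via (1.67); `Thm4TorusFullAt` = the literal four-member (1.62)); no implication between the two interface shapes is claimed (their uniqueness
clauses quantify over different classes).  (vi) Desk rows in flight (`B8Thm2Torus*`, `B8Prop5*` stems) are cited, not carved into; `B8Prop5Reality`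
is IMPORTED for its lemma `isSelfAdjoint_conjR_of_unitary` only.  Count-neutral; no summit statement is proved by this seat; nothing continuum ∕
ℝ⁴ ∕ OS ∕ mass-gap ∕ Clay.
-/

noncomputable section

open scoped BigOperators

namespace Literature.MathematicalPhysics.QuantumFieldTheory.Balaban1983to89.B8Carve02GaugeFixingHyp

open B7Prop1Explicit B7Prop2Explicit B8Ineq132 B8Eq119TwistedAxial
open B8Thm4TorusAt (torusLam Thm4TorusAt Cond166T)
open B8Thm2TorusAt (Thm2TorusAt Concl2T C136T C137T C139T Cond135T)
open B8Eq133Hypotheses (Hyp135)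
open B12Ineq417Flat (shiftCfg)
open B7Eq92Concrete (mgauge)
open B8Eq184Proof (cfgExp)
open B8Eq146AExpansion (lin V2 X1 X2 X3 X4 adR)
open B8Eq151V2Divergence (brk V2_eq_sq_add_brk)
open B8Eq138LandauZd (IsLandau138)
open B7Eq78Linearization (conjR conjR_apply)
open B8Prop5Reality (isSelfAdjoint_conjR_of_unitary)

-- `Site` alone resolves to the torus sites of `Setup.lean` in this namespace; the `ℤ^d` sites of `B7Prop1Explicit` are `LSite` here
-- (the convention of `B8Thm2TorusAt`).
open B7Prop1Explicit renaming Site → LSite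

variable {d : ℕ}

/-! ## §1 p. 85: «if A is Hermitian, then the first expression above is a real part of V₂, and the second is an imaginary part of V₂,
multiplied by i» -/

section HermitianV2

variable {𝔸 : Type*}

/-- **p. 85 [PDF 11], the sentence after (1.49)** verbatim: «This equality holds for arbitrary A in the complexified Lie algebra, but if A is
Hermitian, then the first expression above is a real part of V₂, and the second is an imaginary part of V₂, multiplied by i.»  In the letters of
record of (1.49) (`B8Eq146AExpansion.V2` = first member verbatim; second member `V₂ = (Σᵢxᵢ)² + {…}` = `B8Eq151V2Divergence.V2_eq_sq_add_brk` with
`Σᵢxᵢ = B8Eq146AExpansion.lin` (`= η(D^η_{U₀}A)(p)`) and `{…} = B8Eq151V2Divergence.brk`): «the first expression» `(Σᵢxᵢ)²` is self-adjoint (its own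
real part) and «the second» `{…}` is skew-adjoint (`i` times a self-adjoint element), at the plaquette `p_{μν}(x)`.  Hypothesis shape; proved for
Hermitian `A` over a unitary background in `v2HermitianSplit_of_selfAdjoint`. [cite: Balaban1985RegularSpaces, p.85 (sentence after (1.49))] -/
def V2HermitianSplitPrinted [NormedRing 𝔸] [StarRing 𝔸] (U₀ : LSite d → Fin d → 𝔸ˣ) (A : LSite d → Fin d → 𝔸) (μ ν : Fin d)
    (x : LSite d) : Prop :=
  IsSelfAdjoint (lin U₀ A μ ν x * lin U₀ A μ ν x) ∧ star (brk U₀ A μ ν x) = -brk U₀ A μ ν x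

/-- `[X, Y]⋆ = −[X, Y]` for self-adjoint `X`, `Y`: each commutator in the bracket `{…}` of (1.49) is skew-Hermitian for Hermitian entries — the
algebra behind «the second is an imaginary part of V₂, multiplied by i». [cite: Balaban1985RegularSpaces, p.85 (sentence after (1.49))] -/
theorem star_adR_of_selfAdjoint [NormedRing 𝔸] [StarRing 𝔸] {X Y : 𝔸} (hX : IsSelfAdjoint X) (hY : IsSelfAdjoint Y) :
    star (adR X Y) = -adR X Y := by
  simp only [adR, star_sub, star_mul, hX.star_eq, hY.star_eq, neg_sub]

variable [CStarAlgebra 𝔸]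

/-- The four variables `x₁ = A(x,y)`, `x₂ = R(U₀(x,y))A(y,z)`, `x₃ = R(U₀(x,w))A(z,w)`, `x₄ = A(w,x)` of (1.49) are Hermitian when `A` is Hermitian
and `U₀` is unitary-valued (`R(u)Y = uYu⋆`). [cite: Balaban1985RegularSpaces, (1.49) p.85] -/
theorem X_selfAdjoint {U₀ : LSite d → Fin d → 𝔸ˣ} (hU₀ : ∀ y κ, U₀ y κ ∈ unitaryUnits 𝔸) {A : LSite d → Fin d → 𝔸}
    (hA : ∀ y κ, IsSelfAdjoint (A y κ)) (μ ν : Fin d) (x : LSite d) :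
    IsSelfAdjoint (X1 A μ x) ∧ IsSelfAdjoint (X2 U₀ A μ ν x) ∧ IsSelfAdjoint (X3 U₀ A μ ν x) ∧ IsSelfAdjoint (X4 A ν x) := by
  refine ⟨hA x μ, ?_, ?_, ?_⟩
  · exact isSelfAdjoint_conjR_of_unitary (hU₀ x μ) (hA _ ν)
  · exact isSelfAdjoint_conjR_of_unitary (hU₀ x ν) (hA _ μ).neg
  · exact (hA x ν).neg

/-- `Σᵢxᵢ = η(D^η_{U₀}A)(p)` is Hermitian for Hermitian `A` over a unitary background. [cite: Balaban1985RegularSpaces, (1.49) p.85] -/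
theorem lin_selfAdjoint {U₀ : LSite d → Fin d → 𝔸ˣ} (hU₀ : ∀ y κ, U₀ y κ ∈ unitaryUnits 𝔸) {A : LSite d → Fin d → 𝔸}
    (hA : ∀ y κ, IsSelfAdjoint (A y κ)) (μ ν : Fin d) (x : LSite d) : IsSelfAdjoint (lin U₀ A μ ν x) := by
  obtain ⟨h1, h2, h3, h4⟩ := X_selfAdjoint hU₀ hA μ ν x
  exact ((h1.add h2).add h3).add h4

/-- The bracket `{…}` of (1.49) is skew-Hermitian for Hermitian `A` over a unitary background. [cite: Balaban1985RegularSpaces, (1.49) p.85] -/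
theorem star_brk_of_selfAdjoint {U₀ : LSite d → Fin d → 𝔸ˣ} (hU₀ : ∀ y κ, U₀ y κ ∈ unitaryUnits 𝔸) {A : LSite d → Fin d → 𝔸}
    (hA : ∀ y κ, IsSelfAdjoint (A y κ)) (μ ν : Fin d) (x : LSite d) : star (brk U₀ A μ ν x) = -brk U₀ A μ ν x := by
  obtain ⟨h1, h2, h3, h4⟩ := X_selfAdjoint hU₀ hA μ ν x
  simp only [brk, star_add, star_adR_of_selfAdjoint h1 h2, star_adR_of_selfAdjoint h1 h3, star_adR_of_selfAdjoint h1 h4,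
    star_adR_of_selfAdjoint h2 h3, star_adR_of_selfAdjoint h2 h4, star_adR_of_selfAdjoint h3 h4, neg_add]

/-- **THE p. 85 SENTENCE, PROVED** for bondwise Hermitian `A` («if A is Hermitian») over a unitary-valued background `U₀` (print: `U(N)`):
`(Σᵢxᵢ)²` is self-adjoint and `{…}⋆ = −{…}`. [cite: Balaban1985RegularSpaces, p.85 (sentence after (1.49))] -/
theorem v2HermitianSplit_of_selfAdjoint {U₀ : LSite d → Fin d → 𝔸ˣ} (hU₀ : ∀ y κ, U₀ y κ ∈ unitaryUnits 𝔸) {A : LSite d → Fin d → 𝔸}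
    (hA : ∀ y κ, IsSelfAdjoint (A y κ)) (μ ν : Fin d) (x : LSite d) : V2HermitianSplitPrinted U₀ A μ ν x := by
  refine ⟨?_, star_brk_of_selfAdjoint hU₀ hA μ ν x⟩
  have h := lin_selfAdjoint hU₀ hA μ ν x
  rw [IsSelfAdjoint, star_mul, h.star_eq]

/-- Consequently `V₂⋆ = (Σᵢxᵢ)² − {…}`: the self-adjoint («real») part of `V₂` is `(Σᵢxᵢ)² = η²((D^η_{U₀}A)(p))²` and the skew («i·imaginary»)
part is `{…}`. [cite: Balaban1985RegularSpaces, p.85 (sentence after (1.49)), (1.49) p.85] -/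
theorem star_V2_of_selfAdjoint {U₀ : LSite d → Fin d → 𝔸ˣ} (hU₀ : ∀ y κ, U₀ y κ ∈ unitaryUnits 𝔸) {A : LSite d → Fin d → 𝔸}
    (hA : ∀ y κ, IsSelfAdjoint (A y κ)) (μ ν : Fin d) (x : LSite d) :
    star (V2 U₀ A μ ν x) = lin U₀ A μ ν x * lin U₀ A μ ν x - brk U₀ A μ ν x := by
  obtain ⟨h1, h2⟩ := v2HermitianSplit_of_selfAdjoint hU₀ hA μ ν x
  rw [V2_eq_sq_add_brk, star_add, h1.star_eq, h2, sub_eq_add_neg]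

/-- «a real part of V₂»: `V₂ + V₂⋆ = 2(Σᵢxᵢ)²`; «an imaginary part of V₂, multiplied by i»: `V₂ − V₂⋆ = 2{…}`. [cite: Balaban1985RegularSpaces, p.85 (sentence after (1.49))] -/
theorem V2_add_sub_star_of_selfAdjoint {U₀ : LSite d → Fin d → 𝔸ˣ} (hU₀ : ∀ y κ, U₀ y κ ∈ unitaryUnits 𝔸)
    {A : LSite d → Fin d → 𝔸} (hA : ∀ y κ, IsSelfAdjoint (A y κ)) (μ ν : Fin d) (x : LSite d) :
    V2 U₀ A μ ν x + star (V2 U₀ A μ ν x) = 2 * (lin U₀ A μ ν x * lin U₀ A μ ν x) ∧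
      V2 U₀ A μ ν x - star (V2 U₀ A μ ν x) = 2 * brk U₀ A μ ν x := by
  rw [star_V2_of_selfAdjoint hU₀ hA, V2_eq_sq_add_brk]
  constructor
  · rw [two_mul]; abel
  · rw [two_mul]; abel

end HermitianV2

/-! ## §2 p. 87: the literal displays (1.63)–(1.64) and «The restriction follows from the bounds (1.63), hence from (1.64)» -/

section Restriction

/-- **(1.64) (p. 87 [PDF 13])** verbatim: «hence from  (20dB₁C′₁ + 2(1 + C₂)B₁²C′₁²)(α₀ + α₁) ≦ 1. (1.64)  This is a restriction on α₀ + α₁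
depending on d, L, and C′₁, and in the future considerations we will have to make sure that C′₁ depends on d and L only.»  (`s = α₀ + α₁`; `B₁`,
`C₂` the constants of Prop. 3 ∕ (1.56), `C′₁` that of «α₂ = B′₁(α₀ + α₁) = C′₁B₁(α₀ + α₁)» (p. 87; (1.111) p. 95).)  Hypothesis shape (a display,
typed letter for letter). [cite: Balaban1985RegularSpaces, (1.64) p.87] -/
def Restriction164Printed (d B₁ C₁' C₂ s : ℝ) : Prop :=
  (20 * d * B₁ * C₁' + 2 * (1 + C₂) * B₁ ^ 2 * C₁' ^ 2) * s ≤ 1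

/-- **(1.63) (p. 87 [PDF 13])** verbatim: «This proposition explains how the constants B₁, B₂ may be chosen. Let us make some comments on the
restriction (1.61). In the future we will get a configuration A satisfying (1.41) with α₂ = B′₁(α₀ + α₁) = C′₁B₁(α₀ + α₁). The restriction follows
from the bounds  20dα₂α₀ + 2α₂² + 2C₂α₂² < (20dB₁C′₁ + 2B₁²C′₁² + 2C₂B₁²C′₁²)(α₀ + α₁)² ≦ α₀ + α₁, (1.63)» — both relations of the display (the
first STRICT as printed), with `α₂ := C′₁B₁(α₀ + α₁)` substituted.  Hypothesis shape (a display, typed letter for letter); it holds under (1.64) for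
positive constants (`ineq163_of_164`). [cite: Balaban1985RegularSpaces, (1.63) p.87] -/
def Ineq163Printed (d B₁ C₁' C₂ α₀ α₁ : ℝ) : Prop :=
  20 * d * (C₁' * B₁ * (α₀ + α₁)) * α₀ + 2 * (C₁' * B₁ * (α₀ + α₁)) ^ 2 + 2 * C₂ * (C₁' * B₁ * (α₀ + α₁)) ^ 2 <
      (20 * d * B₁ * C₁' + 2 * B₁ ^ 2 * C₁' ^ 2 + 2 * C₂ * B₁ ^ 2 * C₁' ^ 2) * (α₀ + α₁) ^ 2 ∧
    (20 * d * B₁ * C₁' + 2 * B₁ ^ 2 * C₁' ^ 2 + 2 * C₂ * B₁ ^ 2 * C₁' ^ 2) * (α₀ + α₁) ^ 2 ≤ α₀ + α₁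

/-- The coefficient of (1.64) is that of (1.63): `20dB₁C′₁ + 2(1 + C₂)B₁²C′₁² = 20dB₁C′₁ + 2B₁²C′₁² + 2C₂B₁²C′₁²`. [cite: Balaban1985RegularSpaces, (1.63)–(1.64) p.87] -/
theorem coeff164_eq (d B₁ C₁' C₂ : ℝ) :
    20 * d * B₁ * C₁' + 2 * (1 + C₂) * B₁ ^ 2 * C₁' ^ 2 = 20 * d * B₁ * C₁' + 2 * B₁ ^ 2 * C₁' ^ 2 + 2 * C₂ * B₁ ^ 2 * C₁' ^ 2 := by
  ring

/-- **«hence from (1.64)»**: for positive `d`, `B₁`, `C′₁`, `α₁` and `α₀ ≥ 0` the restriction (1.64) on `α₀ + α₁` gives both relations of (1.63)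
(the strict one is `20dB₁C′₁(α₀ + α₁)·α₁ > 0`; the second is (1.64) multiplied by `α₀ + α₁`). [cite: Balaban1985RegularSpaces, (1.63)–(1.64) p.87] -/
theorem ineq163_of_164 {d B₁ C₁' C₂ α₀ α₁ : ℝ} (hd : 0 < d) (hB₁ : 0 < B₁) (hC₁' : 0 < C₁') (hα₀ : 0 ≤ α₀) (hα₁ : 0 < α₁)
    (h64 : Restriction164Printed d B₁ C₁' C₂ (α₀ + α₁)) : Ineq163Printed d B₁ C₁' C₂ α₀ α₁ := by
  unfold Restriction164Printed at h64
  unfold Ineq163Printed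
  set s := α₀ + α₁ with hs
  have hs0 : 0 < s := by rw [hs]; positivity
  constructor
  · -- RHS − LHS = 20dB₁C′₁·s·α₁ > 0
    have hgap : 0 < 20 * d * B₁ * C₁' * s * α₁ := by positivity
    have hid : (20 * d * B₁ * C₁' + 2 * B₁ ^ 2 * C₁' ^ 2 + 2 * C₂ * B₁ ^ 2 * C₁' ^ 2) * s ^ 2 -
        (20 * d * (C₁' * B₁ * s) * α₀ + 2 * (C₁' * B₁ * s) ^ 2 + 2 * C₂ * (C₁' * B₁ * s) ^ 2) =
        20 * d * B₁ * C₁' * s * (s - α₀) := by ring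
    have hsub : s - α₀ = α₁ := by rw [hs]; ring
    rw [hsub] at hid
    linarith [hid, hgap]
  · have := mul_le_mul_of_nonneg_right h64 hs0.le
    nlinarith [this]

/-- **(1.64) ⇒ (1.61) at `α₂ = C′₁B₁(α₀ + α₁)`** («The restriction follows from the bounds (1.63), hence from (1.64)»; (1.61) p. 86 «Now we assume
further that 2α₂² + 20dα₀α₂ + 2C₂α₂² ≦ α₀ + α₁. (1.61)», in the `h61` shape of `B8.Prop3Body`), for non-negative constants.
[cite: Balaban1985RegularSpaces, (1.61) p.86, (1.63)–(1.64) p.87] -/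
theorem restriction161_of_164 {d B₁ C₁' C₂ α₀ α₁ : ℝ} (hd : 0 ≤ d) (hB₁ : 0 ≤ B₁) (hC₁' : 0 ≤ C₁') (hα₀ : 0 ≤ α₀)
    (hα₁ : 0 ≤ α₁) (h64 : Restriction164Printed d B₁ C₁' C₂ (α₀ + α₁)) :
    2 * (C₁' * B₁ * (α₀ + α₁)) ^ 2 + 20 * d * α₀ * (C₁' * B₁ * (α₀ + α₁)) + 2 * C₂ * (C₁' * B₁ * (α₀ + α₁)) ^ 2 ≤ α₀ + α₁ := by
  unfold Restriction164Printed at h64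
  set s := α₀ + α₁ with hs
  have hs0 : 0 ≤ s := by rw [hs]; positivity
  have hα₀s : α₀ ≤ s := by rw [hs]; linarith
  -- 20dα₀α₂ ≤ 20dB₁C′₁s², the squares are equal; then (1.64)·s
  have h1 : 20 * d * α₀ * (C₁' * B₁ * s) ≤ 20 * d * B₁ * C₁' * s ^ 2 := by
    have h2 : 0 ≤ 20 * d * B₁ * C₁' * s := by positivity
    nlinarith [mul_le_mul_of_nonneg_left hα₀s h2]
  have h3 := mul_le_mul_of_nonneg_right h64 hs0
  nlinarith [h1, h3]

end Restriction

/-! ## §3 The torus letters (`Ω_j = T_η`, `j ≤ k`): (1.41)∕(1.62)₁∕(1.67), Theorem 4's conclusion in two readings, Proposition 3 -/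

section Torus

variable {𝔸 : Type*} [NormedRing 𝔸] [StarRing 𝔸] [NormedAlgebra ℂ 𝔸] [CompleteSpace 𝔸]

omit [StarRing 𝔸] [NormedAlgebra ℂ 𝔸] [CompleteSpace 𝔸] in
/-- **(1.67) (p. 88 [PDF 14]) ∕ (1.41) (p. 83) ∕ the first member of (1.62) (p. 87) FOR `Ω_j = T_η`** — «\|A\| < B′₁(α₀ + α₁)(Lʲη)⁻¹ on Ω_j,
B′₁ = C′₁5B₀ (1.67)», «\|A\| < α₂(Lʲη)⁻¹ on Ω_j, (1.41)»: with every `Ω_j = T_η` the bound `‖A_b‖ < b·s·(Lʲη)⁻¹` at EVERY bond and every `j ≤ k`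
(the `j = k` clause binds).  The torus reading of the carrier field `B8.GFData.C162 b s` ((1.62) read as its \|A\|-member per (1.67)); `(b, s) =
(B′₁, α₀ + α₁)` is (1.67), `(1, α₂)` is (1.41) (as `B8.Prop3Body` types it), `(B₁, α₀ + α₁)` the first member of (1.36) (`B8Thm2TorusAt.C136T`).
[cite: Balaban1985RegularSpaces, (1.67) p.88, (1.41) p.83, (1.62) p.87] -/
def C167T (L k : ℕ) (η b s : ℝ) (A : LSite d → Fin d → 𝔸) : Prop :=
  ∀ j, j ≤ k → ∀ (x : LSite d) (μ : Fin d), ‖A x μ‖ < b * s * ((L : ℝ) ^ j * η)⁻¹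

omit [StarRing 𝔸] [CompleteSpace 𝔸] in
/-- The first member of (1.36) at `(B₁, s)` gives (1.67) at any `(b, s′)` with `B₁s ≤ bs′` (the torus instance of the carrier laws `h136_162`,
`hmono162` of `B8.thm2_of_thm4_prop3`). [cite: Balaban1985RegularSpaces, (1.36) p.82, (1.67) p.88] -/
theorem c167T_of_c136T {L k : ℕ} {η β₀ B₁ B₂ : ℝ} {len : LSite d → ℝ} {s b s' : ℝ} {U₀ : LSite d → Fin d → 𝔸ˣ}
    {A : LSite d → Fin d → 𝔸} (h : C136T L k η β₀ B₁ B₂ len s U₀ A) (hη : 0 ≤ η) (hbs : B₁ * s ≤ b * s') :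
    C167T L k η b s' A := by
  intro j hj x μ
  have hw : 0 ≤ ((L : ℝ) ^ j * η)⁻¹ := inv_nonneg.2 (mul_nonneg (pow_nonneg (Nat.cast_nonneg L) j) hη)
  exact (h.1 j hj x μ).trans_le (mul_le_mul_of_nonneg_right hbs hw)

omit [StarRing 𝔸] [NormedAlgebra ℂ 𝔸] [CompleteSpace 𝔸] in
/-- Monotonicity of (1.67) in its constant. [cite: Balaban1985RegularSpaces, (1.67) p.88] -/
theorem c167T_mono {L k : ℕ} {η b s b' s' : ℝ} {A : LSite d → Fin d → 𝔸} (h : C167T L k η b s A) (hη : 0 ≤ η)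
    (hbs : b * s ≤ b' * s') : C167T L k η b' s' A := by
  intro j hj x μ
  have hw : 0 ≤ ((L : ℝ) ^ j * η)⁻¹ := inv_nonneg.2 (mul_nonneg (pow_nonneg (Nat.cast_nonneg L) j) hη)
  exact (h j hj x μ).trans_le (mul_le_mul_of_nonneg_right hbs hw)

/-- **THEOREM 4's CONCLUSION «(1.37), (1.38), (1.62) hold for the configuration U₁ = U′^{u⁻¹}» (p. 88) FOR `Ω_j = T_η`, IN THE TREE'S
READING OF RECORD of `B8.Thm4Printed`** ((1.62) ↦ its \|A\|-member (1.67) with constant `B′₁`, p. 88 «Proposition 3 implies that it is enough to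
prove (1.37), (1.38) and \|A\| < B′₁(α₀ + α₁)(Lʲη)⁻¹ on Ω_j»): there is a bondwise self-adjoint `P`-periodic `A` with `U′^{u⁻¹} = e^{iηA}`
(`B7Eq92Concrete.mgauge U₀ u⁻¹ U′ = B8Eq184Proof.cfgExp η A`, as in `B8Thm2TorusAt.Concl2T`) satisfying (1.37) `B8Thm2TorusAt.C137T`, (1.38)
`B8Eq138LandauZd.IsLandau138 L k η univ (torusLam k)`, and (1.67) `C167T L k η B′₁ (α₀ + α₁)`.  Token-parallel to `Concl2T`.
[cite: Balaban1985RegularSpaces, Thm 4 p.88, (1.67) p.88, (1.37)–(1.38) p.82] -/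
def Concl4T (L k : ℕ) (P : ℤ) (η B₁' α₀ α₁ : ℝ) (U₀ U' : LSite d → Fin d → 𝔸ˣ) (u : LSite d → 𝔸ˣ) : Prop :=
  ∃ A : LSite d → Fin d → 𝔸,
    (∀ (x : LSite d) (μ : Fin d), IsSelfAdjoint (A x μ)) ∧
    (∀ (x : LSite d) (i : Fin d) (μ : Fin d), A (x + P • e i) μ = A x μ) ∧
    mgauge U₀ u⁻¹ U' = cfgExp η A ∧
    C137T L k η α₁ U₀ A ∧ IsLandau138 L k η (Set.univ : Set (LSite d)) (torusLam k) U₀ A ∧ C167T L k η B₁' (α₀ + α₁) A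

/-- **(1.36)–(1.39) ⇒ (1.37), (1.38), (1.67) when `B₁ ≤ B′₁`** — the torus instance of the law by which a Theorem-2 solution is a Theorem-4
solution (used on p. 88 ∕ in `B8.thm2_of_thm4_prop3` for the uniqueness clause: `h136_162` + `hmono162`, `5dLB₀ ≤ B′₁`).
[cite: Balaban1985RegularSpaces, Thm 4 ⇒ Thm 2 p.88, (1.36)–(1.39) pp.82–83] -/
theorem concl4T_of_concl2T {L k : ℕ} {P : ℤ} {η β₀ B₁ B₂ B₁' : ℝ} {len : LSite d → ℝ} {α₀ α₁ : ℝ}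
    {U₀ U' : LSite d → Fin d → 𝔸ˣ} {u : LSite d → 𝔸ˣ} (h : Concl2T L k P η β₀ B₁ B₂ len α₀ α₁ U₀ U' u) (hη : 0 ≤ η)
    (hs : 0 ≤ α₀ + α₁) (hB : B₁ ≤ B₁') : Concl4T L k P η B₁' α₀ α₁ U₀ U' u := by
  obtain ⟨A, hsa, hper, hexp, h36, h37, h38, -⟩ := h
  exact ⟨A, hsa, hper, hexp, h37, h38, c167T_of_c136T h36 hη (mul_le_mul_of_nonneg_right hB hs)⟩

/-- **THEOREM 4 (p. 88) FOR `Ω_j = T_η` WITH (1.29) AND THE CONCLUSION CONCRETE, tree reading** — verbatim: «Theorem 4. There exists a constant c₁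
such that for arbitrary U₀, U′U₀ satisfying (1.33), (1.34), (1.66) with α₀ + α₁ ≦ c₁ there exists exactly one gauge transformation u satisfying (1.29)
and such that the conditions (1.37), (1.38), (1.62) hold for the configuration U₁ = U′^{u⁻¹}.»: the interface `B8Thm4TorusAt.Thm4TorusAt L k P η c₁
G Reg Restr Concl` (which keeps `Restr`∕`Concl` abstract) AT `Restr := B8Eq119TwistedAxial.Restr129 L k (torusLam k)` ((1.29) of record) and
`Concl := Concl4T L k P η B′₁` — BY NAME; only «(3.35) of [4]» (`Reg`) stays abstract, exactly as in `B8Thm2TorusAt.Thm2TorusAt`.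
[cite: Balaban1985RegularSpaces, Thm 4 p.88, (1.29) p.81, p.77 («Ω_j = T_η for j = 0,1,…,l, l ≤ k»)] -/
def Thm4TorusReadAt (L k : ℕ) (P : ℤ) (η c₁ B₁' : ℝ) (G : Subgroup 𝔸ˣ) (Reg : (LSite d → Fin d → 𝔸ˣ) → Prop) : Prop :=
  Thm4TorusAt L k P η c₁ G Reg (Restr129 L k (torusLam k)) (Concl4T L k P η B₁')

/-- **THEOREM 4 (p. 88) FOR `Ω_j = T_η`, «(1.62)» READ IN FULL** — all four members of the display (1.62) p. 87 («\|A\| < 5dLB₀(α₀ + α₁)(Lʲη)⁻¹,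
\|∇^η_{U₀}A\| < 5dLB₀(α₀ + α₁)(Lʲη)⁻², ‖A‖_{1,β} < 5dLB₀(β)(α₀ + α₁)(Lʲη)^{−2−β}, \|D^{η*}_{U₀}D^η_{U₀}A\|, \|Δ^η_{U₀}A\| < 5dLB₀(α₀ + α₁)(Lʲη)⁻³ on Ω_j»)
together with (1.37), (1.38): this list IS the Theorem-2 list (1.36)–(1.39) at Proposition 3's constants `B₁ = 5dLB₀`, `B₂(β₀) = 5dLB₀(β₀)`, i.e.
`Concl := B8Thm2TorusAt.Concl2T L k P η β₀ (5dLB₀) (5dLB₀(β₀)) len` in `B8Thm4TorusAt.Thm4TorusAt` — which is the content of p. 88 «Of course this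
theorem implies Theorem 2».  BY NAME; `Reg` abstract. [cite: Balaban1985RegularSpaces, Thm 4 p.88, (1.62) p.87, Prop. 3 p.87] -/
def Thm4TorusFullAt (L k : ℕ) (P : ℤ) (η β₀ B₀ B₀β c₁ : ℝ) (len : LSite d → ℝ) (G : Subgroup 𝔸ˣ)
    (Reg : (LSite d → Fin d → 𝔸ˣ) → Prop) : Prop :=
  Thm4TorusAt L k P η c₁ G Reg (Restr129 L k (torusLam k))
    (Concl2T L k P η β₀ (5 * (d : ℝ) * L * B₀) (5 * (d : ℝ) * L * B₀β) len)

/-- **PROPOSITION 3 WITH ITS HYPOTHESES (1.40)–(1.42), (1.61), FOR `Ω_j = T_η`, at the threshold `c`** — p. 83 [PDF 9]: «We assume that we have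
configurations U₀, U₁U₀ satisfying the following conditions  U₀, U₁U₀ ∈ 𝔄_k({Ω_j}, α₀), U₀ satisfies the additional regularity condition (3.35) in
[4], (1.40)  U₁ = e^{iηA}, \|A\| < α₂(Lʲη)⁻¹ on Ω_j, (1.41)  R(U₀)D^{η*}_{U₀}A = 0, Q_j(U₀, ηA) = B on Λ_j, \|B\| < 2dLα₁, (1.42) (j = 0, 1, …, k above).»;
p. 86: «Now we assume further that 2α₂² + 20dα₀α₂ + 2C₂α₂² ≦ α₀ + α₁. (1.61)»; p. 87 [PDF 13]: «Proposition 3. If U₀, U₁U₀ satisfy (1.40)–(1.42)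
with α₀, α₁, α₂ bounded by a constant depending on d and L only, and α₂ satisfies the additional restriction (1.61), then U₁ satisfies
(1.36)–(1.39) with B₁ = 5dLB₀, B₂(β₀) = 5dLB₀(β₀), where B₀, B₀(β₀) are the corresponding norms of the operators G(U₀), H(U₀), and depend on d and
L only, B₀(β₀) on β₀ also.»  Token-parallel to `B8.Prop3Body` on the torus letters of `B8Thm2TorusAt`: data = a `G`-valued `P`-periodic background
`U₀` and a bondwise self-adjoint `P`-periodic `A` with `e^{iηA}` `G`-valued; (1.40) = `InAk L k η α₀ univ U₀ ∧ Reg U₀ ∧ InAk L k η α₀ univ (e^{iηA}·U₀)`;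
(1.41) = `C167T L k η 1 α₂ A`; (1.42) = `IsLandau138 … U₀ A ∧ C137T L k η α₁ U₀ A`; conclusion (1.36) ∧ (1.39) = `C136T`∕`C139T` at `(5dLB₀,
5dLB₀(β₀))`, smallness `α₀ + α₁` ((1.37)∕(1.38) repeat hypotheses and are not restated, as in `B8.Prop3Body`).  General `{Ω_j}` on `ℤᵈ`: the
reading of record is `B8.Prop3Printed … B8LeafModelZd3.zdGF3` (PROVED modulo `SockB9P3`, `B8LeafModelZd3.prop3Printed_zd3`); this is its
`Ω_j = univ` pointwise form.  Hypothesis shape, asserted for nothing. [cite: Balaban1985RegularSpaces, Prop. 3 p.87, (1.40)–(1.42) p.83, (1.61) p.86, (1.62) p.87] -/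
def Prop3TorusBody (c : ℝ) (L k : ℕ) (P : ℤ) (η β₀ B₀ B₀β C₂ : ℝ) (len : LSite d → ℝ) (G : Subgroup 𝔸ˣ)
    (Reg : (LSite d → Fin d → 𝔸ˣ) → Prop) : Prop :=
  ∀ ⦃α₀ α₁ α₂ : ℝ⦄, 0 < α₀ → α₀ ≤ c → 0 < α₁ → α₁ ≤ c → 0 < α₂ → α₂ ≤ c →
    2 * α₂ ^ 2 + 20 * d * α₀ * α₂ + 2 * C₂ * α₂ ^ 2 ≤ α₀ + α₁ →
    ∀ (U₀ : LSite d → Fin d → 𝔸ˣ) (A : LSite d → Fin d → 𝔸),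
      (∀ x κ, U₀ x κ ∈ G) → (∀ i : Fin d, shiftCfg (P • e i) U₀ = U₀) →
      (∀ (x : LSite d) (μ : Fin d), IsSelfAdjoint (A x μ)) → (∀ (x : LSite d) (i : Fin d) (μ : Fin d), A (x + P • e i) μ = A x μ) →
      (∀ x κ, cfgExp η A x κ ∈ G) →
      InAk L k η α₀ (fun _ => Set.univ) U₀ → Reg U₀ → InAk L k η α₀ (fun _ => Set.univ) (cfgExp η A * U₀) →
      C167T L k η 1 α₂ A →
      IsLandau138 L k η (Set.univ : Set (LSite d)) (torusLam k) U₀ A → C137T L k η α₁ U₀ A →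
        C136T L k η β₀ (5 * (d : ℝ) * L * B₀) (5 * (d : ℝ) * L * B₀β) len (α₀ + α₁) U₀ A ∧
        C139T L k η (5 * (d : ℝ) * L * B₀) (α₀ + α₁) U₀ A

/-- **PROPOSITION 3 (p. 87) FOR `Ω_j = T_η`** = `Prop3TorusBody` for some threshold `c(d, L) > 0` («with α₀, α₁, α₂ bounded by a constant depending on
d and L only»), token-parallel to `B8.Prop3Printed`. [cite: Balaban1985RegularSpaces, Prop. 3 p.87] -/
def Prop3TorusAt (L k : ℕ) (P : ℤ) (η β₀ B₀ B₀β C₂ : ℝ) (len : LSite d → ℝ) (G : Subgroup 𝔸ˣ)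
    (Reg : (LSite d → Fin d → 𝔸ˣ) → Prop) : Prop :=
  ∃ c : ℝ, 0 < c ∧ Prop3TorusBody c L k P η β₀ B₀ B₀β C₂ len G Reg

/-- A Proposition-3 body at threshold `c` restricts to any smaller positive threshold. [cite: Balaban1985RegularSpaces, Prop. 3 p.87] -/
theorem prop3TorusBody_anti {c c' : ℝ} (hc : c' ≤ c) {L k : ℕ} {P : ℤ} {η β₀ B₀ B₀β C₂ : ℝ} {len : LSite d → ℝ}
    {G : Subgroup 𝔸ˣ} {Reg : (LSite d → Fin d → 𝔸ˣ) → Prop} (h : Prop3TorusBody c L k P η β₀ B₀ B₀β C₂ len G Reg) :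
    Prop3TorusBody c' L k P η β₀ B₀ B₀β C₂ len G Reg :=
  fun _ _ _ h0 h0c h1 h1c h2 h2c => h h0 (h0c.trans hc) h1 (h1c.trans hc) h2 (h2c.trans hc)

end Torus

/-! ## §4 The bundle keyed to the consumer (stmt-QuantumFields-19200: `B8Thm2TorusAt.Thm2TorusAt`) -/

section Bundle

variable {𝔸 : Type*} [NormedRing 𝔸] [StarRing 𝔸] [NormedAlgebra ℂ 𝔸] [CompleteSpace 𝔸]

/-- **BLOCK 02 BUNDLE — [B8] pp. 83–88 FOR THE DOMAIN SEQUENCE `Ω_j = T_η`** (p. 77 admitted case; `T_η` read as `P`-periodic data on `ℤᵈ`):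
the conjunction BY NAME of the section's three printed statements in the torus letters of the consumer of record — Theorem 2 (p. 83,
`B8Thm2TorusAt.Thm2TorusAt`, constants `B₁, B₂(β₀), c₂`), Proposition 3 (p. 87 with (1.40)–(1.42), (1.61); `Prop3TorusAt`, [4]-constants `B₀,
B₀(β₀)`, [3]-constant `C₂`), Theorem 4 (p. 88; `Thm4TorusReadAt` at `(c₄, B′₁)` — the tree's reading via (1.67) — and `Thm4TorusFullAt` at `(c₄, 5dLB₀,
5dLB₀(β₀))` — (1.62) in full).  «(3.35) of [4]» is the abstract `Reg` throughout.  A node prover takes `(h : Hyp …)` and projects (`Hyp.thm2`, …).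
Hypothesis shape, asserted for nothing; the displays (1.43)–(1.60), (1.63)–(1.65), (1.70)–(1.73) of the same pages are THEOREMS in the tree (module
docstring table) and are therefore not conjoined. [cite: Balaban1985RegularSpaces, Thm 2 p.83, Prop. 3 p.87, Thm 4 p.88] -/
def Hyp (L k : ℕ) (P : ℤ) (η β₀ B₀ B₀β C₂ B₁ B₂ c₂ B₁' c₄ : ℝ) (len : LSite d → ℝ) (G : Subgroup 𝔸ˣ)
    (Reg : (LSite d → Fin d → 𝔸ˣ) → Prop) : Prop :=
  Thm2TorusAt L k P η β₀ B₁ B₂ c₂ len G Reg ∧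
    Prop3TorusAt L k P η β₀ B₀ B₀β C₂ len G Reg ∧
    Thm4TorusReadAt L k P η c₄ B₁' G Reg ∧
    Thm4TorusFullAt L k P η β₀ B₀ B₀β c₄ len G Reg

variable {L k : ℕ} {P : ℤ} {η β₀ B₀ B₀β C₂ B₁ B₂ c₂ B₁' c₄ : ℝ} {len : LSite d → ℝ} {G : Subgroup 𝔸ˣ}
  {Reg : (LSite d → Fin d → 𝔸ˣ) → Prop}

/-- Projection: Theorem 2 (p. 83) for `Ω_j = T_η`. [cite: Balaban1985RegularSpaces, Thm 2 p.83] -/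
theorem Hyp.thm2 (h : Hyp L k P η β₀ B₀ B₀β C₂ B₁ B₂ c₂ B₁' c₄ len G Reg) : Thm2TorusAt L k P η β₀ B₁ B₂ c₂ len G Reg := h.1

/-- Projection: Proposition 3 (p. 87) for `Ω_j = T_η`. [cite: Balaban1985RegularSpaces, Prop. 3 p.87] -/
theorem Hyp.prop3 (h : Hyp L k P η β₀ B₀ B₀β C₂ B₁ B₂ c₂ B₁' c₄ len G Reg) : Prop3TorusAt L k P η β₀ B₀ B₀β C₂ len G Reg := h.2.1

/-- Projection: Theorem 4 (p. 88) for `Ω_j = T_η`, tree reading ((1.37), (1.38), (1.67)). [cite: Balaban1985RegularSpaces, Thm 4 p.88] -/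
theorem Hyp.thm4Read (h : Hyp L k P η β₀ B₀ B₀β C₂ B₁ B₂ c₂ B₁' c₄ len G Reg) : Thm4TorusReadAt L k P η c₄ B₁' G Reg := h.2.2.1

/-- Projection: Theorem 4 (p. 88) for `Ω_j = T_η`, (1.62) read in full. [cite: Balaban1985RegularSpaces, Thm 4 p.88, (1.62) p.87] -/
theorem Hyp.thm4Full (h : Hyp L k P η β₀ B₀ B₀β C₂ B₁ B₂ c₂ B₁' c₄ len G Reg) : Thm4TorusFullAt L k P η β₀ B₀ B₀β c₄ len G Reg :=
  h.2.2.2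

end Bundle

/-! ## §5 (v1.1) Print's quantifier ORDER: the thresholds ∕ constants «depending on d and L only» bound BEFORE the member data `k, P, η` -/

section Uniform

variable {𝔸 : Type*} [NormedRing 𝔸] [StarRing 𝔸] [NormedAlgebra ℂ 𝔸] [CompleteSpace 𝔸]

/-- **PROPOSITION 3 (p. 87), PRINT'S QUANTIFIER ORDER displayed** — «with α₀, α₁, α₂ bounded by a constant depending on d and L only … where B₀,
B₀(β₀) … depend on d and L only, B₀(β₀) on β₀ also»: ONE threshold `c` (given `d`, `L`, the gauge group `G`, `β₀`, the [4]∕[3] letters `B₀, B₀(β₀),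
C₂` and the lineage's length function `len`) serves EVERY number of levels `k ≥ 1`, every period `P` and every spacing `η > 0`; the clause «(3.35) of
[4]» may depend on the member (`Reg k P η`).  Token-parallel to `B8Thm2TorusAt.Thm2TorusUniform`.  Hypothesis shape, asserted for nothing.
[cite: Balaban1985RegularSpaces, Prop. 3 p.87] -/
def Prop3TorusUniform (L : ℕ) (β₀ B₀ B₀β C₂ : ℝ) (len : LSite d → ℝ) (G : Subgroup 𝔸ˣ)
    (Reg : ℕ → ℤ → ℝ → (LSite d → Fin d → 𝔸ˣ) → Prop) : Prop :=
  ∃ c : ℝ, 0 < c ∧ ∀ (k : ℕ) (P : ℤ) (η : ℝ), 1 ≤ k → 0 < η → Prop3TorusBody c L k P η β₀ B₀ B₀β C₂ len G (Reg k P η)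

/-- The uniform form hands each member its Proposition 3. [cite: Balaban1985RegularSpaces, Prop. 3 p.87] -/
theorem prop3TorusAt_of_uniform {L : ℕ} {β₀ B₀ B₀β C₂ : ℝ} {len : LSite d → ℝ} {G : Subgroup 𝔸ˣ}
    {Reg : ℕ → ℤ → ℝ → (LSite d → Fin d → 𝔸ˣ) → Prop} (h : Prop3TorusUniform L β₀ B₀ B₀β C₂ len G Reg) {k : ℕ} (hk : 1 ≤ k)
    (P : ℤ) {η : ℝ} (hη : 0 < η) : Prop3TorusAt L k P η β₀ B₀ B₀β C₂ len G (Reg k P η) := by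
  obtain ⟨c, hc, H⟩ := h
  exact ⟨c, hc, H k P η hk hη⟩

omit [StarRing 𝔸] in
/-- The interface `B8Thm4TorusAt.Thm4TorusAt` is ANTITONE in its threshold: a statement for `α₀ + α₁ ≤ c₁` gives the statement for `α₀ + α₁ ≤ c₁′`
whenever `c₁′ ≤ c₁` (print: «with α₀ + α₁ ≦ c₁»). [cite: Balaban1985RegularSpaces, Thm 4 p.88] -/
theorem thm4TorusAt_anti {L k : ℕ} {P : ℤ} {η c₁ c₁' : ℝ} {G : Subgroup 𝔸ˣ} {Reg : (LSite d → Fin d → 𝔸ˣ) → Prop}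
    {Restr : (LSite d → Fin d → 𝔸ˣ) → (LSite d → 𝔸ˣ) → Prop}
    {Concl : ℝ → ℝ → (LSite d → Fin d → 𝔸ˣ) → (LSite d → Fin d → 𝔸ˣ) → (LSite d → 𝔸ˣ) → Prop}
    (h : Thm4TorusAt L k P η c₁ G Reg Restr Concl) (hc : c₁' ≤ c₁) : Thm4TorusAt L k P η c₁' G Reg Restr Concl :=
  fun _ _ h0 h1 hs => h h0 h1 (hs.trans hc)

/-- **THEOREM 4 (p. 88), PRINT'S QUANTIFIER ORDER displayed, tree reading** — «There exists a constant c₁ such that for arbitrary U₀, U′U₀ …» and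
(1.67) «with an absolute constant C′₁, i.e. a constant depending on d and L only» (`B′₁ = C′₁5B₀`): ONE pair `(c₁, B′₁)` (given `d`, `L`, `G`) serves
every member `k ≥ 1`, `P`, `η > 0`; «(3.35) of [4]» may depend on the member.  Hypothesis shape, asserted for nothing.
[cite: Balaban1985RegularSpaces, Thm 4 p.88, (1.67) p.88] -/
def Thm4TorusReadUniform (L : ℕ) (G : Subgroup 𝔸ˣ) (Reg : ℕ → ℤ → ℝ → (LSite d → Fin d → 𝔸ˣ) → Prop) : Prop :=
  ∃ c₁ B₁' : ℝ, 0 < c₁ ∧ 0 < B₁' ∧ ∀ (k : ℕ) (P : ℤ) (η : ℝ), 1 ≤ k → 0 < η → Thm4TorusReadAt L k P η c₁ B₁' G (Reg k P η)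

/-- **THEOREM 4 (p. 88), PRINT'S QUANTIFIER ORDER displayed, (1.62) read in full** — ONE threshold `c₁` (given `d`, `L`, `G`, `β₀`, the [4] letters
`B₀, B₀(β₀)`, `len`) serves every member `k ≥ 1`, `P`, `η > 0`.  Hypothesis shape, asserted for nothing. [cite: Balaban1985RegularSpaces, Thm 4 p.88, (1.62) p.87] -/
def Thm4TorusFullUniform (L : ℕ) (β₀ B₀ B₀β : ℝ) (len : LSite d → ℝ) (G : Subgroup 𝔸ˣ)
    (Reg : ℕ → ℤ → ℝ → (LSite d → Fin d → 𝔸ˣ) → Prop) : Prop :=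
  ∃ c₁ : ℝ, 0 < c₁ ∧ ∀ (k : ℕ) (P : ℤ) (η : ℝ), 1 ≤ k → 0 < η → Thm4TorusFullAt L k P η β₀ B₀ B₀β c₁ len G (Reg k P η)

/-- **BLOCK 02 IN PRINT'S QUANTIFIER ORDER** — Theorem 2 («There exist constants B₁, B₂(β₀), c₁ …», `B8Thm2TorusAt.Thm2TorusUniform`), Proposition 3
(`Prop3TorusUniform`), Theorem 4 in both readings (`Thm4TorusReadUniform`, `Thm4TorusFullUniform`): every constant «depending on d and L only» is bound
BEFORE the member data `k, P, η`.  Hypothesis shape, asserted for nothing; the member bundle `Hyp` follows (`hyp_of_uniform`).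
[cite: Balaban1985RegularSpaces, Thm 2 p.83, Prop. 3 p.87, Thm 4 p.88] -/
def HypUniform (L : ℕ) (β₀ B₀ B₀β C₂ : ℝ) (len : LSite d → ℝ) (G : Subgroup 𝔸ˣ)
    (Reg : ℕ → ℤ → ℝ → (LSite d → Fin d → 𝔸ˣ) → Prop) : Prop :=
  B8Thm2TorusAt.Thm2TorusUniform L β₀ len G Reg ∧ Prop3TorusUniform L β₀ B₀ B₀β C₂ len G Reg ∧
    Thm4TorusReadUniform L G Reg ∧ Thm4TorusFullUniform L β₀ B₀ B₀β len G Reg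

/-- **The uniform block hands each member `k ≥ 1`, `P`, `η > 0` its bundle `Hyp`** (Theorem 4's two readings at the common threshold
`min c₄ c₄′`, by `thm4TorusAt_anti`). [cite: Balaban1985RegularSpaces, Thm 2 p.83, Prop. 3 p.87, Thm 4 p.88] -/
theorem hyp_of_uniform {L : ℕ} {β₀ B₀ B₀β C₂ : ℝ} {len : LSite d → ℝ} {G : Subgroup 𝔸ˣ}
    {Reg : ℕ → ℤ → ℝ → (LSite d → Fin d → 𝔸ˣ) → Prop} (h : HypUniform L β₀ B₀ B₀β C₂ len G Reg) {k : ℕ} (hk : 1 ≤ k) (P : ℤ)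
    {η : ℝ} (hη : 0 < η) :
    ∃ B₁ B₂ c₂ B₁' c₄ : ℝ, 0 < B₁ ∧ 0 < B₂ ∧ 0 < c₂ ∧ 0 < B₁' ∧ 0 < c₄ ∧
      Hyp L k P η β₀ B₀ B₀β C₂ B₁ B₂ c₂ B₁' c₄ len G (Reg k P η) := by
  obtain ⟨h2, h3, ⟨c₄, B₁', hc₄, hB₁', H4⟩, ⟨c₄', hc₄', H4'⟩⟩ := h
  obtain ⟨B₁, B₂, c₂, hB₁, hB₂, hc₂, H2⟩ := B8Thm2TorusAt.thm2TorusAt_of_uniform h2 hk P hη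
  refine ⟨B₁, B₂, c₂, B₁', min c₄ c₄', hB₁, hB₂, hc₂, hB₁', lt_min hc₄ hc₄', H2, prop3TorusAt_of_uniform h3 hk P hη, ?_, ?_⟩
  · exact thm4TorusAt_anti (H4 k P η hk hη) (min_le_left _ _)
  · exact thm4TorusAt_anti (H4' k P η hk hη) (min_le_right _ _)

end Uniform

end Literature.MathematicalPhysics.QuantumFieldTheory.Balaban1983to89.B8Carve02GaugeFixingHyp

end
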